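import Mathlib
import Summits.KontsevichZagierPeriods.Zeta5Search.DenomLaw.LongProfiles18Path
import Summits.KontsevichZagierPeriods.Zeta5Search.DenomLaw.Profile17aPath
import HarnessLib

/-!
# ζ(5) search — PATH ACCOUNTING FOR EVERY SORTED PARAMETER VECTOR ON THE SEVEN LONGEST FIRST-PERIOD PROFILES, IN ONE STATEMENT (`N_p ≥ 17`)

Cell `pub-zeta5` (HONEST FRAMING: systematic search; no irrationality claim unless certified), TRACK «DENOM-LAW» D1 prover seat
(denom-prover-d1 g18, `HOME/denom-law/prover-d1/ATTEMPT-18.md` §2).  `FullProfile.pathAccountingFirstPeriod_long18` (this generation: the node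
`DenomLaw.PathAccountingFirstPeriod` for every sorted `b` at every first-period prime at which all seven parameters and at least 18 of the 21 pair blocks reach
`p`, full profile up to `d < 4p`) extended by the two `N_p = 17` profiles — branch `(2,3)` (`DenomLaw/Profile17bPath`: THEOREM LB, whole profile) and branch
`(1,5)` (`DenomLaw/Profile17aPath`: THEOREM A⁗ at `(8,[1,−5,−5,1])`, below `d = 3p`; its cell `3p ≤ d` — node `−8`, 54 of 2,989 instances at `p ≤ 11` — is
OPEN).  For a sorted vector «at least 17 pair blocks reach `p`» reads: (`p ≤ b₀−b₁−b₆` and `p ≤ b₀−b₂−b₃`) or (`p ≤ b₀−b₁−b₅` and `p ≤ b₀−b₂−b₄`).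
**`pathAccountingFirstPeriod_long17`: the node, binders VERBATIM, plus `p ≤ b₇`, that disjunction, `d < 4p`, and `d < 3p` whenever `b₀ − b₁ − b₅ < p`**
(the last two hypotheses bite only on the full profile's corner and on the open cell of branch `(1,5)`).  Seven general-`b` profile theorems; no ray, no family.
MODEL/structure-side valuation bookkeeping of the cell's own rationals; nothing about ζ(5); no γ; records in print UNMOVED.
-/

namespace Summit.KontsevichZagierPeriods.Zeta5Search.FullProfile

open Summit.KontsevichZagierPeriods.Zeta5Search.CasoratianValuation (InPolytope shift casoratian pairFloors refund)
open Summit.KontsevichZagierPeriods.Zeta5Search.WedgeDictionary (dOf)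
open Summit.KontsevichZagierPeriods.Zeta5Search.DenomLaw (cStar FirstPeriod Sorted7)
open Summit.KontsevichZagierPeriods.Zeta5Search.DenomLaw.FirstPeriodKit (sorted7_chain)

/-- **`PathAccountingFirstPeriod`'s conclusion for EVERY sorted `b` on the profiles `N_p ≥ 17`, every direction `j`**: all seven parameters reach `p`, at
least 17 pair blocks reach `p` ((`b₀−b₁−b₆` and `b₀−b₂−b₃`) or (`b₀−b₁−b₅` and `b₀−b₂−b₄`) reach `p`), `d(b) < 4p`, and `d(b) < 3p` if `b₀ − b₁ − b₅ < p`. -/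
theorem pathAccounting_long17 (b : ℕ → ℤ) (j p : ℕ) (hb : InPolytope b) (hs : Sorted7 b) (hbj : InPolytope (shift b j))
    (hj1 : 1 ≤ j) (hj7 : j ≤ 7) (hprime : p.Prime) (hp5 : 5 ≤ p) (hwin : (b 0 + 2 : ℤ) < (p : ℤ) ^ 2) (hfp : FirstPeriod b p)
    (hP : (p : ℤ) ≤ b 7)
    (hor : ((p : ℤ) + b 1 + b 6 ≤ b 0 ∧ (p : ℤ) + b 2 + b 3 ≤ b 0) ∨ ((p : ℤ) + b 1 + b 5 ≤ b 0 ∧ (p : ℤ) + b 2 + b 4 ≤ b 0))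
    (hd4 : dOf b < 4 * (p : ℤ)) (hd3 : b 0 < (p : ℤ) + b 1 + b 5 → dOf b < 3 * (p : ℤ)) (hcas : casoratian b j ≠ 0) :
    dOf b / (p : ℤ) - pairFloors b p - min (if 2 ≤ dOf b / (p : ℤ) then (1 : ℤ) else 0) (5 - (cStar b p : ℤ))
      ≤ padicValRat p (casoratian b j) := by
  obtain ⟨h21, h32, h43, h54, h65, h76⟩ := sorted7_chain hs
  by_cases h15 : (p : ℤ) + b 1 + b 5 ≤ b 0
  · by_cases h18 : (p : ℤ) + b 1 + b 4 ≤ b 0 ∨ (p : ℤ) + b 2 + b 3 ≤ b 0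
    · exact pathAccounting_long18 b j p hb hs hbj hj1 hj7 hprime hp5 hwin hfp hP h15 h18 hd4 hcas
    · push Not at h18
      have h24 : (p : ℤ) + b 2 + b 4 ≤ b 0 := by
        rcases hor with ⟨-, h23⟩ | ⟨-, h24⟩
        · exact absurd h23 (not_le.2 h18.2)
        · exact h24
      exact pathAccounting_profile17b b j p hb hs hbj hj1 hj7 hprime hp5 hwin hfp hP (by linarith) (by linarith) h15 h24 hcas
  · push Not at h15
    obtain ⟨h16, h23⟩ : (p : ℤ) + b 1 + b 6 ≤ b 0 ∧ (p : ℤ) + b 2 + b 3 ≤ b 0 := by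
      rcases hor with h | ⟨h15', -⟩
      · exact h
      · exact absurd h15' (not_le.2 h15)
    exact pathAccounting_profile17a b j p hb hs hbj hj1 hj7 hprime hp5 hwin hfp hP h15 h16 h23 (hd3 h15) hcas

/-- **THE NODE FOR EVERY SORTED `b` ON THE PROFILES `N_p ≥ 17`: `PathAccountingFirstPeriod` with its binders VERBATIM plus `p ≤ b₇`,
((`p + b₁ + b₆ ≤ b₀ ∧ p + b₂ + b₃ ≤ b₀`) ∨ (`p + b₁ + b₅ ≤ b₀ ∧ p + b₂ + b₄ ≤ b₀`)) — all parameters and at least seventeen pair blocks reach `p` —,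
`d(b) < 4p`, and `d(b) < 3p` whenever `b₀ < p + b₁ + b₅`.** -/
theorem pathAccountingFirstPeriod_long17 :
    ∀ (b : ℕ → ℤ) (p : ℕ), InPolytope b → Sorted7 b → InPolytope (shift b 7) →
      p.Prime → 5 ≤ p → (b 0 + 2 : ℤ) < (p : ℤ) ^ 2 → FirstPeriod b p → (p : ℤ) ≤ b 7 →
      (((p : ℤ) + b 1 + b 6 ≤ b 0 ∧ (p : ℤ) + b 2 + b 3 ≤ b 0) ∨ ((p : ℤ) + b 1 + b 5 ≤ b 0 ∧ (p : ℤ) + b 2 + b 4 ≤ b 0)) →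
      dOf b < 4 * (p : ℤ) → (b 0 < (p : ℤ) + b 1 + b 5 → dOf b < 3 * (p : ℤ)) → casoratian b 7 ≠ 0 →
        dOf b / (p : ℤ) - pairFloors b p - min (if 2 ≤ dOf b / (p : ℤ) then (1 : ℤ) else 0) (5 - (cStar b p : ℤ))
          ≤ padicValRat p (casoratian b 7) :=
  fun b p hb hs hb7 hprime hp5 hwin hfp hP hor hd4 hd3 hcas =>
    pathAccounting_long17 b 7 p hb hs hb7 (by norm_num) (by norm_num) hprime hp5 hwin hfp hP hor hd4 hd3 hcas

end Summit.KontsevichZagierPeriods.Zeta5Search.FullProfile
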